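import Literature.NumberTheory.EllipticCurves.HeegnerPointsKolyvaginConjugation
import Literature.NumberTheory.EllipticCurves.WeilPairingProofs
import HarnessLib

/-!
# Matar–Nekovář 2019, Thm. 0.3 (b) / Prop. 6.4 (C6): at a prime where `E[p]` is REDUCIBLE,
# Kolyvagin's eigenspace condition fails — a `G_ℚ`-stable line of `E[p]` is an eigenline of
# complex conjugation (PROVED; theorems only, no named fact)

A. Matar, J. Nekovář, *Kolyvagin's result on the vanishing of `Ш(E/K)[p^∞]` and its consequences
for anticyclotomic Iwasawa theory*, J. Théor. Nombres Bordeaux **31** (2019) 455–501 (held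
`paper:doi-10-5802-jtnb-1091`). Thm. 0.3 (p. 456, corpus p0003 L9–L12), Kolyvagin's condition
"(b) Neither of the `(±1)`-eigenspaces `E[p]^±` for the action of complex conjugation is stable
under the action of `G_ℚ := Gal(ℚ̄/ℚ)`. Equivalently, the (mod `p`) Galois representation
`ρ̄_{E,p} : G_ℚ ⟶ Aut_{𝔽_p}(E[p]) ≃ GL₂(𝔽_p)` is irreducible."; Prop. 6.4 (pp. 497–498, corpus
p0044 L46 – p0045 L6): "(C6) Neither of the two subgroups `E[p]^± ⊂ E[p]` (:= the
`(±1)`-eigenspaces for the action of complex conjugation) contains a non-zero `G_K` stable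
subgroup (equivalently, `ρ` is irreducible)", used (proof of Prop. 6.4, p0045 L14–L15) "in the
proof of [Gross 1991, Prop. 9.5 (2)]". The same error term is Kolyvagin's `b = 2b′` in
Perrin-Riou's Bourbaki report (exp. 717, Astérisque 189–190 (1990), Lemme 3.3, corpus
`paper:url-c7ad8120f411` p0029 L2–L5: "`b′A` est nul pour tout sous-module galoisien `A` … tel que
`(σ+1)A = 0` [ou] `(σ−1)A = 0`").

This file PROVES the direction of the printed "equivalently" that the cell `bsd-litref` (tranche
T3, flag `LW16-Thm14-disputed-MN19-0.11`) uses: **if `E[p]` is reducible (`p` odd), then some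
non-zero proper `G_ℚ`-stable subgroup of `E[p]` lies inside an eigenspace `E[p]^ε` of complex
conjugation** (any prime `p`) — so Kolyvagin's condition (b) = Gross's (C6) FAILS at every reducible pair, for
every choice of the quadratic field `K` (a `G_ℚ`-stable subgroup is `G_K`-stable). Elementary:
a proper non-zero `G_ℚ`-stable `H ≤ E[p] ≅ (ℤ/p)²` has order `p`, so complex conjugation `c₀`
(an involution of `G_ℚ`, `IsComplexConjugation`) acts on the cyclic group `H` by an integer `u`
with `u² ≡ 1 (mod p)`, i.e. by `±1`. Vocabulary: the tree's `WeierstrassCurve.HasIrreducibleModPGaloisRep`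
(`GaloisAction.lean`), `geomTorsion`, `IsComplexConjugation (Rat.castHom ℝ) c₀`
(`GaloisRepresentations/AbsGaloisGroup.lean`), as in `HeegnerPointsKolyvaginConjugation.lean`
(whose `exists_eigenvectors` is the complementary statement that BOTH eigenspaces are lines).
Typer seat `bsd-litref-lw16-ty` (cell `bsd-litref/lw16`); companion of the pre-audit sheet
`run/shared/lean/pub/bsd-litref/lw16/sheets/PREAUDIT-lw16-ty.md` (§1 LOCUS, FINDING F3).
Theorems only; nothing asserted about Kolyvagin's bound itself.
-/

noncomputable section

open scoped Classical
open WeierstrassCurve NumberField Field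
open Literature.NumberTheory.GaloisRepresentations

namespace Literature.NumberTheory.EllipticCurves.MatarNekovar2019

variable (W : WeierstrassCurve ℚ) [W.IsElliptic] {p : ℕ} [Fact p.Prime]
variable {c₀ : absoluteGaloisGroup ℚ} (hc₀ : IsComplexConjugation (Rat.castHom ℝ) c₀)

omit [W.IsElliptic] [Fact p.Prime] in
/-- Every geometric `p`-torsion point is killed by `p` (unfolding `geomTorsion = torsionBy`).
[folklore] -/
private theorem natCast_smul_eq_zero_of_geomTorsion (P : geomTorsion W p) : (p : ℤ) • P = 0 := by
  have := (mem_geomTorsion_iff W p _).mp P.2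
  exact Subtype.ext (by rw [AddSubgroupClass.coe_zsmul]; exact this)

/-- **A proper non-zero `G_ℚ`-stable subgroup of `E[p]` has order `p`** (`#E[p] = p²`,
Silverman *AEC* III.6.4(b) = the tree theorem `card_torsionPoints_eq_sq_holds`). [folklore] -/
private theorem natCard_eq_of_ne_bot_of_ne_top (H : AddSubgroup (geomTorsion W p)) (hbot : H ≠ ⊥)
    (htop : H ≠ ⊤) : Nat.card H = p := by
  have hp : p.Prime := Fact.out
  have hcard : Nat.card (geomTorsion W p) = p ^ 2 :=
    card_torsionPoints_eq_sq_holds W (AlgebraicClosure ℚ) (by exact_mod_cast hp.ne_zero)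
  haveI : Finite (geomTorsion W p) :=
    Nat.finite_of_card_ne_zero (by rw [hcard]; exact pow_ne_zero _ hp.ne_zero)
  have hdvd : Nat.card H ∣ p ^ 2 := by
    have h := AddSubgroup.card_addSubgroup_dvd_card H
    rwa [hcard] at h
  obtain ⟨k, hk, hk'⟩ := (Nat.dvd_prime_pow hp).mp hdvd
  interval_cases k
  · exact absurd (AddSubgroup.eq_bot_of_card_eq H (by simpa using hk')) hbot
  · simpa using hk'
  · exact absurd (AddSubgroup.eq_top_of_card_eq H (by rw [hk', hcard])) htop

include hc₀ in
/-- **Matar–Nekovář 2019, Thm. 0.3 (b) "equivalently" / Prop. 6.4 (C6), the direction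
reducible ⇒ (b) fails, PROVED** (for every prime `p`; the paper assumes `p ≠ 2`). Let `c₀ ∈ G_ℚ` be a complex conjugation.
If `E[p]` is NOT an irreducible `G_ℚ`-module (`¬ W.HasIrreducibleModPGaloisRep p`), then there are
a subgroup `H ≤ E[p]`, non-zero and proper (`H ≠ ⊥`, `H ≠ ⊤`; it has order `p`), stable under ALL of
`G_ℚ` (hence under `G_K` for any field `K`), and a sign `ε ∈ {1, −1}` with `c₀ • P = ε • P` for
every `P ∈ H` — i.e. `H ⊂ E[p]^ε`: an eigenspace of complex conjugation contains a non-zero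
`G_ℚ`-stable subgroup, which is the negation of Kolyvagin's condition (b) of Thm. 0.3 (= (C6) of
Prop. 6.4, used in Gross 1991 Prop. 9.5 (2); = the error term `b′` of Kolyvagin's Cor. 12/13 in
Perrin-Riou's Lemme 3.3). Proof: `#H = p` (previous lemma), so `H = ℤ·P₀` for any non-zero
`P₀ ∈ H`; `c₀ P₀ ∈ H` gives `c₀ P₀ = u P₀`, and `c₀² = 1` gives `p ∣ u² − 1 = (u−1)(u+1)`.
[cite: MatarNekovar2019, Thm. 0.3 (b) (p. 456) and Prop. 6.4 (C6) with its proof (pp. 497–498)]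
[cite: GrossLMS1991, Prop. 9.5] -/
theorem exists_stable_eigenline_of_not_irreducible
    (hred : ¬ W.HasIrreducibleModPGaloisRep p) :
    ∃ (H : AddSubgroup (geomTorsion W p)) (ε : ℤ), H ≠ ⊥ ∧ H ≠ ⊤ ∧ (ε = 1 ∨ ε = -1) ∧
      (∀ σ : absoluteGaloisGroup ℚ, ∀ P ∈ H, σ • P ∈ H) ∧ ∀ P ∈ H, c₀ • P = ε • P := by
  have hp : p.Prime := Fact.out
  have hpZ : Prime (p : ℤ) := Nat.prime_iff_prime_int.mp hp
  unfold WeierstrassCurve.HasIrreducibleModPGaloisRep at hred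
  push Not at hred
  obtain ⟨H, hstab, hbot, htop⟩ := hred
  have hHcard : Nat.card H = p := natCard_eq_of_ne_bot_of_ne_top W H hbot htop
  haveI : Finite H := Nat.finite_of_card_ne_zero (by rw [hHcard]; exact hp.ne_zero)
  -- a non-zero point of `H`
  obtain ⟨P₀, hP₀H, hP₀⟩ : ∃ P₀ ∈ H, P₀ ≠ 0 := by
    by_contra h
    push Not at h
    exact hbot ((AddSubgroup.eq_bot_iff_forall H).mpr h)
  -- `H = ℤ • P₀`
  have hzm : AddSubgroup.zmultiples P₀ = H := by
    have hle : AddSubgroup.zmultiples P₀ ≤ H := AddSubgroup.zmultiples_le.mpr hP₀H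
    have hne : AddSubgroup.zmultiples P₀ ≠ ⊥ := by
      rwa [Ne, AddSubgroup.zmultiples_eq_bot]
    have h1 : Nat.card (AddSubgroup.zmultiples P₀) ∣ p := by
      have h := AddSubgroup.card_dvd_of_le hle
      rwa [hHcard] at h
    rcases (Nat.dvd_prime hp).mp h1 with h | h
    · exact absurd (AddSubgroup.eq_bot_of_card_eq _ h) hne
    · exact AddSubgroup.eq_of_le_of_card_ge hle (by rw [h, hHcard])
  -- `c₀ P₀ = u P₀`
  obtain ⟨u, hu⟩ : ∃ u : ℤ, u • P₀ = c₀ • P₀ := by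
    have hmem := hstab c₀ P₀ hP₀H
    rw [← hzm, AddSubgroup.mem_zmultiples_iff] at hmem
    exact hmem
  -- `c₀² = 1` forces `p ∣ (u - 1)(u + 1)`
  have hord : addOrderOf P₀ = p :=
    addOrderOf_eq_prime (by
      have := natCast_smul_eq_zero_of_geomTorsion W P₀
      rwa [natCast_zsmul] at this) hP₀
  have hcc : c₀ • c₀ • P₀ = P₀ := by rw [← mul_smul, ← pow_two, hc₀.sq_eq_one, one_smul]
  have huu : (u * u - 1) • P₀ = 0 := by
    rw [sub_smul, one_smul, ← smul_smul, hu, smul_comm u c₀ P₀, hu, hcc, sub_self]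
  have hdvd : (p : ℤ) ∣ (u - 1) * (u + 1) := by
    have : (u - 1) * (u + 1) = u * u - 1 := by ring
    rw [this, ← hord, addOrderOf_dvd_iff_zsmul_eq_zero]
    exact huu
  -- the sign
  have hsign : ∃ ε : ℤ, (ε = 1 ∨ ε = -1) ∧ c₀ • P₀ = ε • P₀ := by
    rcases hpZ.dvd_mul.mp hdvd with h | h
    · refine ⟨1, Or.inl rfl, ?_⟩
      have h0 : (u - 1) • P₀ = 0 := by
        rw [← addOrderOf_dvd_iff_zsmul_eq_zero, hord]; exact h
      rw [sub_smul, one_smul, sub_eq_zero] at h0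
      rw [← hu, h0, one_smul]
    · refine ⟨-1, Or.inr rfl, ?_⟩
      have h0 : (u + 1) • P₀ = 0 := by
        rw [← addOrderOf_dvd_iff_zsmul_eq_zero, hord]; exact h
      rw [add_smul, one_smul, add_eq_zero_iff_eq_neg] at h0
      rw [← hu, h0, neg_smul, one_smul]
  obtain ⟨ε, hε, hεP₀⟩ := hsign
  refine ⟨H, ε, hbot, htop, hε, hstab, fun P hP ↦ ?_⟩
  rw [← hzm, AddSubgroup.mem_zmultiples_iff] at hP
  obtain ⟨n, rfl⟩ := hP
  rw [smul_comm c₀ n P₀, hεP₀, smul_comm]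

include hc₀ in
/-- **Kolyvagin's condition (b) of Matar–Nekovář Thm. 0.3 implies irreducibility** (the
contrapositive, in the form a consumer quoting Thm. 0.3 uses): if NO eigenspace of complex
conjugation on `E[p]` contains a non-zero `G_ℚ`-stable subgroup (stated here for proper subgroups,
which is weaker to assume), then `E[p]` is an irreducible `G_ℚ`-module (any prime `p`; printed for `p ≠ 2`).
[cite: MatarNekovar2019, Thm. 0.3 (b) (p. 456): "(b) … Equivalently, … `ρ̄_{E,p}` … is irreducible"] -/
theorem hasIrreducibleModPGaloisRep_of_conditionB
    (hB : ∀ (H : AddSubgroup (geomTorsion W p)) (ε : ℤ), H ≠ ⊥ → H ≠ ⊤ → (ε = 1 ∨ ε = -1) →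
      (∀ σ : absoluteGaloisGroup ℚ, ∀ P ∈ H, σ • P ∈ H) → ∃ P ∈ H, c₀ • P ≠ ε • P) :
    W.HasIrreducibleModPGaloisRep p := by
  by_contra hred
  obtain ⟨H, ε, hbot, htop, hε, hstab, hH⟩ :=
    exists_stable_eigenline_of_not_irreducible W hc₀ hred
  obtain ⟨P, hP, hne⟩ := hB H ε hbot htop hε hstab
  exact hne (hH P hP)

/-! ### Appended (same seat, 2026-08-26): Matar–Nekovář Thm. 0.3 (b) "Equivalently" in BOTH
### directions — for `p` odd, "neither eigenspace `E[p]^±` of complex conjugation is `G_ℚ`-stable"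
### is EQUIVALENT to irreducibility of `E[p]` (Weil pairing: `c₀` has both eigenlines)

The eigenspace `E[p]^ε = {P ∈ E[p] : c₀ P = ε P}` is used through the kernel of the additive map
`P ↦ c₀ P − ε P` (no new definition). For `p ≠ 2` both `E[p]^{+}` and `E[p]^{−}` are LINES: non-zero
by `RatClosure.exists_eigenvectors` and proper by `RatClosure.not_forall_smul_eq_sign` (determinant
`χ̄_p(c₀) = −1` via the Weil pairing — the tree THEOREM `WeierstrassCurve.exists_weilPairing_holds`,
Silverman *AEC* III.8.1 — so `c₀ ≠ ±1` on `E[p]`), file `HeegnerPointsKolyvaginConjugation.lean`. -/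

section ConditionB

omit [W.IsElliptic] [Fact p.Prime] in
/-- The eigenspace `E[p]^ε = {P : c₀ • P = ε • P}` is a subgroup of `E[p]` (the kernel of the
additive map `P ↦ c₀ • P − ε • P`; no named definition is introduced). Private plumbing. [folklore] -/
private theorem exists_eigenSubgroup (c₀ : absoluteGaloisGroup ℚ) (ε : ℤ) :
    ∃ K : AddSubgroup (geomTorsion W p), ∀ P, P ∈ K ↔ c₀ • P = ε • P := by
  refine ⟨(DistribSMul.toAddMonoidHom (geomTorsion W p) c₀ - ε • AddMonoidHom.id (geomTorsion W p)).ker,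
    fun P ↦ ?_⟩
  rw [AddMonoidHom.mem_ker]
  simp only [AddMonoidHom.sub_apply, DistribSMul.toAddMonoidHom_apply, AddMonoidHom.smul_apply,
    AddMonoidHom.id_apply]
  exact sub_eq_zero

include hc₀ in
/-- **For `p` odd each eigenspace `E[p]^ε` (`ε = ±1`) of complex conjugation is a LINE**: a
subgroup `K = {P : c₀ P = ε P}` of `E[p] ≅ (ℤ/p)²` is neither `⊥` (an `ε`-eigenvector exists) nor
`⊤` (`c₀` is not the scalar `ε`, its determinant being `−1` by the Weil pairing), hence has order
`p`. Gross 1991, Prop. 9.5 (1) ("`E_p^+ ≃ ℤ/pℤ`"); McCallum 1991 §3 ("both a plus and a minus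
eigenspace"). [cite: GrossLMS1991, Prop. 9.5 (1)] -/
theorem natCard_eigenspace_eq (hp2 : p ≠ 2) {ε : ℤ} (hε : ε = 1 ∨ ε = -1)
    (K : AddSubgroup (geomTorsion W p)) (hK : ∀ P, P ∈ K ↔ c₀ • P = ε • P) :
    K ≠ ⊥ ∧ K ≠ ⊤ ∧ Nat.card K = p := by
  have hW : W.exists_weilPairing p := exists_weilPairing_holds W p
  have hbot : K ≠ ⊥ := by
    obtain ⟨⟨vp, hvp, hcvp⟩, ⟨vm, hvm, hcvm⟩⟩ := RatClosure.exists_eigenvectors W hc₀ hW hp2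
    intro h
    rcases hε with rfl | rfl
    · have : vp ∈ K := (hK vp).mpr (by rw [hcvp, one_smul])
      rw [h, AddSubgroup.mem_bot] at this
      exact hvp this
    · have : vm ∈ K := (hK vm).mpr (by rw [hcvm, neg_smul, one_smul])
      rw [h, AddSubgroup.mem_bot] at this
      exact hvm this
  have htop : K ≠ ⊤ := by
    intro h
    apply RatClosure.not_forall_smul_eq_sign W hc₀ hW hp2 hε
    intro P
    have : P ∈ K := by rw [h]; exact AddSubgroup.mem_top P
    exact (hK P).mp this
  exact ⟨hbot, htop, natCard_eq_of_ne_bot_of_ne_top W _ hbot htop⟩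

include hc₀ in
/-- **Matar–Nekovář 2019, Thm. 0.3 (b), direction "irreducible ⇒ (b)"**: for `p` odd, if `E[p]` is an
irreducible `G_ℚ`-module then NEITHER eigenspace `E[p]^±` of complex conjugation is `G_ℚ`-stable —
for each sign there are `σ ∈ G_ℚ` and `P` with `c₀ P = ε P` but `c₀ (σ P) ≠ ε (σ P)` (an
eigenspace is a line, and a stable line contradicts irreducibility).
[cite: MatarNekovar2019, Thm. 0.3 (b) (JTNB 31 (2019) p. 456): "(b) Neither of the (±1)-eigenspaces E[p]^± … is stable under the action of G_ℚ … Equivalently, … ρ̄_{E,p} … is irreducible"] -/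
theorem conditionB_of_hasIrreducibleModPGaloisRep (hp2 : p ≠ 2)
    (hirr : W.HasIrreducibleModPGaloisRep p) {ε : ℤ} (hε : ε = 1 ∨ ε = -1) :
    ∃ (σ : absoluteGaloisGroup ℚ) (P : geomTorsion W p), c₀ • P = ε • P ∧ c₀ • σ • P ≠ ε • σ • P := by
  by_contra h
  push Not at h
  obtain ⟨K, hK⟩ := exists_eigenSubgroup W (p := p) c₀ ε
  obtain ⟨hbot, htop, -⟩ := natCard_eigenspace_eq W hc₀ hp2 hε K hK
  have hstab : ∀ σ : absoluteGaloisGroup ℚ, ∀ P ∈ K, σ • P ∈ K :=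
    fun σ P hP ↦ (hK _).mpr (h σ P ((hK P).mp hP))
  rcases hirr _ hstab with h0 | h1
  · exact hbot h0
  · exact htop h1

include hc₀ in
/-- **Matar–Nekovář 2019, Thm. 0.3 (b), direction "(b) ⇒ irreducible"**: for `p` odd, if neither
eigenspace `E[p]^±` of complex conjugation is `G_ℚ`-stable, then `E[p]` is irreducible. (If `E[p]`
were reducible, `exists_stable_eigenline_of_not_irreducible` gives a stable line `H ⊂ E[p]^ε`; both
have order `p`, so `H = E[p]^ε` would be stable.)
[cite: MatarNekovar2019, Thm. 0.3 (b) (p. 456), "Equivalently"] -/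
theorem hasIrreducibleModPGaloisRep_of_conditionB' (hp2 : p ≠ 2)
    (hB : ∀ ε : ℤ, (ε = 1 ∨ ε = -1) →
      ∃ (σ : absoluteGaloisGroup ℚ) (P : geomTorsion W p), c₀ • P = ε • P ∧ c₀ • σ • P ≠ ε • σ • P) :
    W.HasIrreducibleModPGaloisRep p := by
  by_contra hred
  obtain ⟨H, ε, hbot, htop, hε, hstab, hH⟩ :=
    exists_stable_eigenline_of_not_irreducible W hc₀ hred
  obtain ⟨K, hK⟩ := exists_eigenSubgroup W (p := p) c₀ ε
  -- `H = E[p]^ε` by cardinality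
  have hle : H ≤ K := fun P hP ↦ (hK P).mpr (hH P hP)
  obtain ⟨-, -, hcardK⟩ := natCard_eigenspace_eq W hc₀ hp2 hε K hK
  have hcardH : Nat.card H = p := natCard_eq_of_ne_bot_of_ne_top W H hbot htop
  haveI : Finite K := Nat.finite_of_card_ne_zero (by rw [hcardK]; exact (Fact.out : p.Prime).ne_zero)
  have hHK : H = K := AddSubgroup.eq_of_le_of_card_ge hle (by rw [hcardK, hcardH])
  obtain ⟨σ, P, hP, hσP⟩ := hB ε hε
  have hPH : P ∈ H := by rw [hHK]; exact (hK P).mpr hP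
  exact hσP (hH _ (hstab σ P hPH))

include hc₀ in
/-- **Matar–Nekovář 2019, Thm. 0.3 (b): "(b) … Equivalently, ρ̄_{E,p} is irreducible"** — for an odd
prime `p` and a complex conjugation `c₀ ∈ G_ℚ`, the mod-`p` representation of `E/ℚ` is irreducible
iff neither eigenspace `E[p]^{+}`, `E[p]^{−}` of `c₀` is `G_ℚ`-stable. Kolyvagin's hypothesis (b)
(= Gross's (C6), Perrin-Riou's error term `b′`) is thus EXACTLY irreducibility; in particular it
fails at every prime of a rational `p`-isogeny.
[cite: MatarNekovar2019, Thm. 0.3 (b) (JTNB 31 (2019) p. 456); Prop. 6.4 (C6) (pp. 497–498)] -/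
theorem hasIrreducibleModPGaloisRep_iff_conditionB (hp2 : p ≠ 2) :
    W.HasIrreducibleModPGaloisRep p ↔ ∀ ε : ℤ, (ε = 1 ∨ ε = -1) →
      ∃ (σ : absoluteGaloisGroup ℚ) (P : geomTorsion W p), c₀ • P = ε • P ∧ c₀ • σ • P ≠ ε • σ • P :=
  ⟨fun hirr _ hε ↦ conditionB_of_hasIrreducibleModPGaloisRep W hc₀ hp2 hirr hε,
    hasIrreducibleModPGaloisRep_of_conditionB' W hc₀ hp2⟩

end ConditionB

end Literature.NumberTheory.EllipticCurves.MatarNekovar2019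

end
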